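import Summits.QuantumFields.YangMills.Theorems.BalabanUVNodesN26AtTheta13LiveAtSlopeBelowBetaBoxTowerFlat
import Literature.MathematicalPhysics.QuantumFieldTheory.Balaban1983to89.Node00.Record13NumericsOfThm1CCM

/-!
# DAG node N26 ∕ row (D4) — THE (D4) LANE AT THE K0 WITNESS OF RECORD `θ₁₅ᶜᶜᴹ(j)` (dag-n21-c's COLLARED member `theta13OfThm1CCM F N j ε₀ ε₂₉ B₃ B₃′ a₀ a₁`, `M = M₁ = L^j`;
# plan g77's K0⁷ skeleton V16 of record and the announced V17 read their β-leaf at `betaOfRecord₁₃ F 2 θ₁₅ᶜᶜᴹ(3)`): the rows-below, the rows-(D4) ∧ B4 residue `AtSlopeCont` at the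
# displayed box and its β-BOX below ONE threshold in the (2.9) letter — BY `rfl` MEMBERSHIP in K0a's all-numerics live family, as TERMS of the witness-generic theorems (H) p511525
# §0 and «T13LIVE-ATSLOPE-BELOW-BETABOX» p519684; and the SIGN-FREE β-box of V17's shape 3ᴬ at `θ₁₅ᶜᶜᴹ(j)` from the jets-free pair there, BY NAME from (I) p518667

Cell `pub-balaban`, β-function sub-cell, BINDER row (D4) OWNER lineage `b2b-balaban-beta-an4` (gen 150); helper for crux K2⁷ `EndpointGivenBR13SepCoPH` (stmt-QuantumFields-20543;
registered skeleton `K2Skeleton13SepCoPH.lean` 6c3fc4f2e0bdd8aa, stubs `stub_d1Residue13 : D1AtRecord13` ∕ `stub_d4AtSlopeCont13 : D4AtSlopeOfD1Record13`), `--supports` only.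

WHY (located 2026-08-27, pub-ymgap bus I.22609 ∕ I.22622 ∕ I.22672 ∕ I.22721 ∕ I.22724).  The K0⁷ road (`Record13SepCoPHInhabited`, stmt-QuantumFields-20541) re-pinned its witness to the
collared member `θ₁₅ᶜᶜᴹ(3)` (dag-n21-c g11∕g12, `Node00/Record13NumericsOfThm1CCM`; V16 of record registers `stub_betaSignWindowAtThm1WitnessCCM13` at
`betaOfRecord₁₃ F 2 (theta13OfThm1CCM F 2 3 ε₀ ε₂₉ B₃ B₃′ a₀ a₁)`), and the plan's announced V17 weakens that stub to the SIGN-FREE β-box 3ᴬ «`BetaLowerH (−β′) γ₀ ∧ BetaUpperH β′ γ₀`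
on SOME window», naming as its supplier junction IN THE TREE this lineage's (I) `…N26AtRecord13BetaBoxOfDriftAtSlope.exists_betaBox_betaOfRecord₁₃_of_jetsFreePair` — the jets-free
pair «(D1) one-loop drift + (D4) at-slope continuity» at that record (ym-nodeO-ideate P3 EVIDENCE n°78; plan g77 I.22622 «HAS A SUPPLIER JUNCTION IN THE TREE»).  The (D4) half of that
pair is what this lineage's witness-GENERIC rows-below theorems deliver MODULO the displayed NODE O ∕ B ∕ E inputs along `e ↦ θ₁₃(n, e)` for EVERY numerics `n` ((H)
`…N26AtTheta13LiveStubD4BelowOfDriftTowerFlat` p511525, «T13LIVE-ATSLOPE-BELOW-BETABOX» `…N26AtTheta13LiveAtSlopeBelowBetaBoxTowerFlat` p519684) — and `θ₁₅ᶜᶜᴹ(j)` IS the member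
`θ₁₃(stage12NumericsOfThm1CCM F.L j ε₀ B₃ B₃′ a₀ a₁, ·)` (`Node00.theta13OfThm1CCM_eq`, `rfl`), whose `s2`∕`lf` letters are the C-route's (`stage12NumericsOfThm1CCM_s2`, `rfl`: the collar
changed only `ν.M₁` and `τ9.M`, which the (D4) rows never read).  No tree file types the N26 ∕ (D4) faces at `θ₁₅ᶜᶜᴹ` (dag-n26-c's `…N26AtTheta13OfThm1CC1` is the unit branch); this
file is that edition — three applications, zero new mathematics.

WHAT THIS FILE PROVES (0 `def`, 0 `sorry`):
* §0 `exists_thr_rows_theta13OfThm1CCM` — rows G, Z, N1 at the faithful letters `{ c₀ with ε₁ := e, A₂ := e·9·64·K₀(64,8)² }`, the seam `e·K_rem,L ≤ s` and `4e < ε₀` at EVERY member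
  `θ₁₅ᶜᶜᴹ(j; ε₀, e; …)`, `0 < e ≤ ē` — (H) §0 `exists_thr_rows_theta13LiveOfNumerics` at `n := stage12NumericsOfThm1CCM F.L j ε₀ B₃ B₃′ a₀ a₁` (κ threshold: `kappaThreshold_le_2e4` +
  `kp_n10_theta13OfThm1CCM`; sign windows: `stage12NumericsOfThm1CCM_pos` under `1 ≤ F.L`, `0 < ε₀`, `0 ≤ B₃`, `0 ≤ B₃′`, `0 < a₀`, `0 < a₁`) — the CCM twin of (H) §2's checks at θ₁₅ᶜ ∕ θ₁₅ᶜᶜ¹.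
* §1 ★ `exists_thr_atSlopeCont_betaBox_below_theta13OfThm1CCM_of_family_towerFlat` — «T13LIVE-ATSLOPE-BELOW-BETABOX»'s ★ at that `n`, SPELLED at `θ₁₅ᶜᶜᴹ(j)`: for NE9's tower data and
  every slope `s > 0` there is `ē > 0` such that AT EVERY `0 < ε₂₉ ≤ ē` the member is admissible with `ZtUnity`, `4ε₂₉ < ε₀`, and — from the displayed NODE O ∕ 00 ∕ A, NODE B, NODE E
  inputs there + N3 + `Valid` + (C-leaf) ALONE (NODE D supplied on the flat tower; N1 + seam PAID by §0) — `AtSlopeCont (split₁₃ θ₁₅ᶜᶜᴹ(j)) γ₀ s` at the displayed box `γ₀ ≤ θ.γ = ½` AND,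
  for every (D1) drift `(d, A)` of the member's `β⁰`, the β-BOX `BetaLowerH b γ₀ β₁₃ ∧ BetaUpperH β′ γ₀ β₁₃` (`b ≤ d − 2A − s`, `d + 2A + s ≤ β′`) at `β₁₃ = betaOfRecord₁₃ F N θ₁₅ᶜᶜᴹ(j)`.
  This is the (D4) HALF of the jets-free pair at V16∕V17's witness (any `j`, so `j = 3`), modulo exactly the inputs displayed at θ₁₅ᶜ ∕ θ₁₅ᶜᶜ¹ before — nothing weaker, nothing stronger.
* §2 `exists_betaBox_betaOfRecord₁₃_theta13OfThm1CCM_of_jetsFreePair` — V17's 3ᴬ letter shape at `θ₁₅ᶜᶜᴹ(j)` BY NAME: the jets-free pair at that record ⟹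
  `∃ γ₀ ∈ ]0, θ.γ], ∃ β′ ≥ 0, BetaUpperH β′ γ₀ β₁₃ ∧ BetaLowerH (−β′) γ₀ β₁₃ ∧ BetaContH γ₀ β₁₃` ((I) `exists_betaBox_betaOfRecord₁₃_of_jetsFreePair` at `θ := θ₁₅ᶜᶜᴹ(j)`; `θ.γ = ½` by
  `rfl`) — the supplier junction plan g77 ∕ P3 n°78 name, read at the witness they name.

HONEST FRAMING.  REDUCTIONS along one family below a threshold and one by-name instantiation — NOT a proof of `stub_d4AtSlopeCont13`, NOT a proof of V16's ∕ V17's stub 3: §1's NODE O ∕ B ∕ E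
inputs are DISPLAYED hypotheses, proved nowhere; §2's jets-free pair is a HYPOTHESIS ((D1) = N25 ∕ row D1's; (D4) = NODE O's); (D4) INSTANCE 0∕1, D4 DISCHARGE NO DATE; K0⁷ ∕ K2⁷ NOT
proved; N25 ∕ N26 NOT discharged; counts unmoved.  One finite 𝕋⁴ programme at fixed ε per run — NOT continuum, NOT ℝ⁴, NOT infinite volume, NOT OS, NOT a mass gap, NOT Clay.
No `instance`, no `notation`, no `axiom`.  Sources (context): [I] = [Balaban1987RG1] CMP **109** (1987): Thm 2 p. 259, §1 p. 264 ((1.20)–(1.22)), (2.9) p. 266, (2.12)–(2.14) p. 268,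
(4.4) p. 281, (5.10) p. 293; [II] = [Balaban1988RG2Cluster] CMP **116** (1988): Lemma 3 (2.38) p. 20, (2.41) p. 21; [III] = [Balaban1988Convergent] CMP **119** (1988): (2.4) p. 255,
(2.10) p. 256; [IV] = [Balaban1989LargeFieldI] CMP **122** (1989): (0.3) p. 176; [15] = [Balaban1985Variational] CMP **102** (1985): Thm 1 p. 279, (190) p. 308;
[6] = [Balaban1985RegularSpaces] CMP **102** (1985): Prop. 6 p. 99.
-/

noncomputable section

open scoped Matrix.Norms.L2Operator InnerProductSpace ComplexConjugate

namespace Summit.QuantumFields.YangMills.Theorems.BalabanUVNodesN26AtTheta13OfThm1CCMStubD4Below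

open Literature.MathematicalPhysics.QuantumFieldTheory.Balaban1983to89
open Literature.MathematicalPhysics.QuantumFieldTheory.Balaban1983to89.FlowStep
open Literature.MathematicalPhysics.QuantumFieldTheory.Balaban1983to89.T4Continuum (T4Family)
open Literature.MathematicalPhysics.QuantumFieldTheory.Balaban1983to89.Node00
open Literature.MathematicalPhysics.QuantumFieldTheory.Balaban1983to89.B13ScaleTransfer (Pt)
open Literature.MathematicalPhysics.QuantumFieldTheory.Balaban1983to89.TreeLengthTorus (TPt TDom proj)
open Literature.MathematicalPhysics.QuantumFieldTheory.Balaban1983to89.B4Sect5Torus (TSite)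
open Literature.MathematicalPhysics.QuantumFieldTheory.Balaban1983to89.B12Decay510 (mixedDeriv)
open Literature.MathematicalPhysics.QuantumFieldTheory.Balaban1983to89.B12Decay510Torus (tcubeOf)
open Literature.MathematicalPhysics.QuantumFieldTheory.Balaban1983to89.B9SectCLatticeCarrier (Bond bpos)
open Literature.MathematicalPhysics.QuantumFieldTheory.Balaban1983to89.B9Eq311L2Pairing (WL2)
open Literature.MathematicalPhysics.QuantumFieldTheory.Balaban1983to89.B9Eq315QTower (towerP UlevOf)
open Literature.MathematicalPhysics.QuantumFieldTheory.Balaban1983to89.B9Eq315QTorus (perCfg cornerSite)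
open Literature.MathematicalPhysics.QuantumFieldTheory.Balaban1983to89.B9Eq319QprimeTorus (blockCoord)
open Literature.MathematicalPhysics.QuantumFieldTheory.Balaban1983to89.B9Eq316TowerFlatIsOneStep (siteCast towerP_eq_fineP_pow)
open Literature.MathematicalPhysics.QuantumFieldTheory.Balaban1983to89.B7Prop1Explicit (U1 Wcx boxVec)
open Literature.MathematicalPhysics.QuantumFieldTheory.Balaban1983to89.B7Prop2Explicit (c2')
open Literature.MathematicalPhysics.QuantumFieldTheory.Balaban1983to89.B11Eq103H1Complex (BondL2K)
open Literature.MathematicalPhysics.QuantumFieldTheory.Balaban1983to89.B9Eq326OperatorTower (laplaceAk H1k)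
open Literature.MathematicalPhysics.QuantumFieldTheory.Balaban1983to89.Beta.RemainderChainLattice
open Literature.MathematicalPhysics.QuantumFieldTheory.Balaban1983to89.Beta.RemainderLimitTorus (LDom limKernel tproj)
open Literature.MathematicalPhysics.QuantumFieldTheory.Balaban1983to89.Beta.RemainderDecay190 (Consts190 Data190)
open Literature.MathematicalPhysics.QuantumFieldTheory.Balaban1983to89.Beta.RemainderDecay190HoloChain (ChainTFac190H)
open Literature.MathematicalPhysics.QuantumFieldTheory.Balaban1983to89.Beta.RemainderWOfRecordB13 (SpLaw Law213 NOfLayers)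
open Summit.QuantumFields.BalabanUV.Gaps
open Summit.QuantumFields.BalabanUV.Gaps.BetaContFromD4Chain
open Summit.QuantumFields.YangMills.Theorems.BalabanUVNodesN26AtRecord13FamilyTowerFlat
  (exists_chainTFac190H_betaOfRecord₁₃_of_family_towerFlat)
open Literature.MathematicalPhysics.QuantumFieldTheory.Balaban1983to89.B12TreeDecay (K₀ K₀_pos)
open Summit.QuantumFields.YangMills.Theorems.BalabanUVNodesN26AtRecord13Family (condsL_faithful_theta13LiveOfNumerics_iff_of_kappa_ge)
open Summit.QuantumFields.YangMills.Theorems.BalabanUVNodesN26AtRecord12KappaSufficient (kappaThreshold_le_2e4)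
open Metric Filter Topology
open Literature.MathematicalPhysics.QuantumFieldTheory.Balaban1983to89.Beta.OneStepKernelFamily (TbalOf)
open Literature.MathematicalPhysics.QuantumFieldTheory.Balaban1983to89.Beta.OneStepResolventKernel (JetData)
open Summit.QuantumFields.YangMills.Theorems.BalabanUVNodesN26AtTheta13LiveStubD4BelowOfDriftTowerFlat (exists_thr_rows_theta13LiveOfNumerics)

open Literature.MathematicalPhysics.QuantumFieldTheory.Balaban1983to89.Beta.Drift (OneLoopDrift)
open Summit.QuantumFields.YangMills.Theorems.BalabanUVNodesN26AtRecord13BetaBoxOfDriftAtSlope (betaBox_of_drift_atSlopeCont)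
open Summit.QuantumFields.YangMills.Theorems.BalabanUVNodesN26AtTheta13LiveAtSlopeBelowBetaBoxTowerFlat
  (exists_thr_atSlopeCont_betaBox_below_theta13LiveOfNumerics_of_family_towerFlat)
open Summit.QuantumFields.YangMills.Theorems.BalabanUVNodesN26AtRecord13BetaBoxOfDriftAtSlope (exists_betaBox_betaOfRecord₁₃_of_jetsFreePair)

variable (F : T4Family) (N : ℕ) [NeZero N]

/-! ## §0 The β-side rows below a threshold at `θ₁₅ᶜᶜᴹ(j)` -/

section Rows

variable (j : ℕ) (ε₀ B₃ B₃' a₀ a₁ : ℝ) (c₀ : B13.Consts) (M : ℕ) (α₂ B : ℝ)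

variable {ε₀ B₃ B₃' a₀ a₁} in
/-- **The (D4) lane's β-side rows below a threshold AT THE COLLARED WITNESS `θ₁₅ᶜᶜᴹ(j)`** (rows G, Z, N1 at the faithful letters, the seam `e·K_rem,L ≤ s`, `4e < ε₀`, for every member
`0 < e ≤ ē`): (H) §0 `exists_thr_rows_theta13LiveOfNumerics` at `n := stage12NumericsOfThm1CCM F.L j ε₀ B₃ B₃′ a₀ a₁`, accepted as a TERM of the θ₁₅ᶜᶜᴹ-spelled statement
(`Node00.theta13OfThm1CCM_eq` is `rfl`) — the CCM twin of (H) §2's checks at θ₁₅ᶜ ∕ θ₁₅ᶜᶜ¹; κ threshold by `kp_n10_theta13OfThm1CCM`, sign windows by `stage12NumericsOfThm1CCM_pos`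
(`1 ≤ F.L` from `F.hL`).  Satisfiability of displayed rows; nothing of Bałaban's; instance 0∕1.
[cite: Balaban1987RG1, (0.21) p.256, (1.2) p.260, (2.9) p.266 and (1.22) p.264; Balaban1988RG2Cluster, Lemma 3 (2.38) p.20 and p.21 (after (2.39), after (2.41)); Balaban1988Convergent, (2.4) p.255, (2.10) p.256; Balaban1985Variational, Thm 1 p.279; Balaban1985RegularSpaces, Prop. 6 p.99 (the collar)] -/
theorem exists_thr_rows_theta13OfThm1CCM (hε : 0 < ε₀) (hB : 0 ≤ B₃) (hB' : 0 ≤ B₃') (ha₀ : 0 < a₀) (ha₁ : 0 < a₁) {s : ℝ} (hs : 0 < s) :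
    ∃ ē : ℝ, 0 < ē ∧ ∀ e : ℝ, 0 < e → e ≤ ē →
      4 * e < ε₀ ∧
      (theta13OfThm1CCM F N j ε₀ e B₃ B₃' a₀ a₁).Admissible F N ∧ (theta13OfThm1CCM F N j ε₀ e B₃ B₃' a₀ a₁).ZtUnity F N ∧
      CondsL 4 (c13OfRecord₁₂ F N (theta13OfThm1CCM F N j ε₀ e B₃ B₃' a₀ a₁).toStage12Params
          { c₀ with ε₁ := e, A₂ := Real.exp 1 * 9 * 64 * K₀ 64 8 ^ 2 })
        (((c13OfRecord₁₂ F N (theta13OfThm1CCM F N j ε₀ e B₃ B₃' a₀ a₁).toStage12Params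
          { c₀ with ε₁ := e, A₂ := Real.exp 1 * 9 * 64 * K₀ 64 8 ^ 2 }).L : ℝ) / 2) ∧
      e * remCoeffL 4 M (c13OfRecord₁₂ F N (theta13OfThm1CCM F N j ε₀ e B₃ B₃' a₀ a₁).toStage12Params
          { c₀ with ε₁ := e, A₂ := Real.exp 1 * 9 * 64 * K₀ 64 8 ^ 2 }) α₂ B ≤ s :=
  exists_thr_rows_theta13LiveOfNumerics F N c₀ M α₂ B (n := stage12NumericsOfThm1CCM F.L j ε₀ B₃ B₃' a₀ a₁)
    (kappaThreshold_le_2e4.trans (kp_n10_theta13OfThm1CCM F N j ε₀ 0 B₃ B₃' a₀ a₁)) (stage12NumericsOfThm1CCM_pos F.hL.2.le hε hB hB' ha₀ ha₁) hs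

end Rows

/-! ## §1 ★ The rows-(D4) ∧ B4 residue and its β-box below a threshold at `θ₁₅ᶜᶜᴹ(j)` (NODE D supplied on NE9's flat tower) -/

section Below
-- NE9's tower structure data ([5] §3 ∕ [15]: block size `L ≥ 3`, the C⋆-algebra `𝔸`, its Hilbert model `W ≃ 𝔸`, the trace `τ`, `a, a′, ρ_w, A_Q`; the letters `a, a′` are `aQ, aQ'` here — K0a's witness owns the names `a₀, a₁`)
variable (L : ℕ) [NeZero L] (hL : 1 ≤ L) (hL3 : 3 ≤ L)
  {𝔸 : Type*} [CStarAlgebra 𝔸] [Nontrivial 𝔸]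
  {W : Type} [NormedAddCommGroup W] [InnerProductSpace ℂ W] [FiniteDimensional ℂ W] (φ : W ≃ₗ[ℂ] 𝔸)
  {Mφ Mφ' : ℝ} (hMφ : 0 ≤ Mφ) (hMφ' : 0 ≤ Mφ') (hφ : ∀ w, ‖φ w‖ ≤ Mφ * ‖w‖) (hφ' : ∀ X, ‖φ.symm X‖ ≤ Mφ' * ‖X‖)
  {aQ : ℝ} (haQ : 0 < aQ) {aQ' : ℝ} (haQ' : 0 < aQ')
  (τ : 𝔸 →ₗ[ℂ] ℂ) {Cτ : ℝ} (hτ : ∀ X, ‖τ X‖ ≤ Cτ * ‖X‖) (hCτ : 0 ≤ Cτ) {Mτ : ℝ}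
  (hτm : ∀ X Y : 𝔸, ‖τ (X * Y)‖ ≤ Mτ * ‖X‖ * ‖Y‖) (hMτ : 0 ≤ Mτ) {ρw : ℝ} (hρw : 0 ≤ ρw)
  (hτ₁ : ∀ X : 𝔸, τ (star X) = conj (τ X)) (hτ₂ : ∀ X Y : 𝔸, τ (X * Y) = τ (Y * X))
  (hφτ : ∀ X Y : 𝔸, ⟪φ.symm X, φ.symm Y⟫_ℂ = τ (star X * Y))
  (AQ : ℝ) (hAQ16 : 16 * (((4 : ℕ) : ℝ) + 1) * (((4 : ℕ) : ℝ) + 4) * c2' 4 L ≤ AQ)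

include hL3 hMφ hMφ' hφ hφ' haQ haQ' hτ hCτ hτm hMτ hρw hτ₁ hτ₂ hφτ hAQ16

variable (j : ℕ) (ε₀ B₃ B₃' a₀ a₁ : ℝ)

variable {ε₀ B₃ B₃' a₀ a₁} in
set_option maxRecDepth 100000 in
/-- **★ THE (D4) HALF OF THE JETS-FREE PAIR AT THE K0 WITNESS OF RECORD `θ₁₅ᶜᶜᴹ(j)`, BELOW ONE THRESHOLD, MODULO THE DISPLAYED INPUTS**: «T13LIVE-ATSLOPE-BELOW-BETABOX»
`exists_thr_atSlopeCont_betaBox_below_theta13LiveOfNumerics_of_family_towerFlat` (p519684) at `n := stage12NumericsOfThm1CCM F.L j ε₀ B₃ B₃′ a₀ a₁`, SPELLED at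
`θ₁₅ᶜᶜᴹ(j) = theta13OfThm1CCM F N j ε₀ ε₂₉ B₃ B₃′ a₀ a₁` (`theta13OfThm1CCM_eq`, `rfl`): for NE9's tower data, weights, `M`, geometry, `q`, a box `γ₀`, channel, `α₂`, residual `c₀` and EVERY
slope `s > 0` THERE IS `ē > 0` such that AT EVERY MEMBER `0 < ε₂₉ ≤ ē`: `4ε₂₉ < ε₀`, Admissible, `ZtUnity`, and from the NODE O ∕ 00 ∕ A, NODE B, NODE E inputs there + N3 + `Valid` +
(C-leaf) ALONE: `AtSlopeCont (split₁₃ θ₁₅ᶜᶜᴹ(j)) γ₀ s` at the displayed box `γ₀ ≤ θ₁₅ᶜᶜᴹ(j).γ` AND, for every drift `(d, A)` of the member's one-loop numbers and every `b ≤ d − 2A − s`,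
`d + 2A + s ≤ β′`, the β-BOX `BetaLowerH b γ₀ β₁₃ ∧ BetaUpperH β′ γ₀ β₁₃` at `β₁₃ = betaOfRecord₁₃ F N θ₁₅ᶜᶜᴹ(j)`.  A REDUCTION — the displayed inputs are HYPOTHESES, proved nowhere;
instance 0∕1; nothing of Bałaban's asserted.
[cite: Balaban1987RG1, Thm 2 p.259, (1.20)-(1.22) p.264, (2.9) p.266, (2.12)-(2.14) p.268, (4.4) p.281, (4.35) p.290, (5.10) p.293; Balaban1988RG2Cluster, Lemma 3 (2.38) p.20 and (2.41) p.21; Balaban1988Convergent, (2.4) p.255, (2.10) p.256; Balaban1989LargeFieldI, (0.3) p.176; Balaban1985Variational, Thm 1 p.279, (190) p.308; Balaban1985RegularSpaces, Prop. 6 p.99 (the collar)] -/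
theorem exists_thr_atSlopeCont_betaBox_below_theta13OfThm1CCM_of_family_towerFlat
    (hε : 0 < ε₀) (hB : 0 ≤ B₃) (hB' : 0 ≤ B₃') (ha₀ : 0 < a₀) (ha₁ : 0 < a₁) :
    ∃ δs Cs : ℝ, 0 < δs ∧ 0 ≤ Cs ∧
      ∀ -- tower weights per scale `k` (height `k + 1`)
        (η : ℕ → ℝ) (_hηL : ∀ k, η k * (L : ℝ) ^ (k + 1) = 1) (cw₀ cw₁ : ℕ → ℝ) [∀ k, Fact (0 < cw₀ k)] [∀ k, Fact (0 < cw₁ k)]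
        (_hw : ∀ k, cw₀ k * ((L : ℝ) ^ (k + 1)) ^ 4 = cw₁ k) (_hρ : ∀ k, |η k| ^ 4 / cw₀ k ≤ ρw)
        -- cube side, size indices, block-geometry letters, source direction ∕ value, the (190)-record under numerics only
        (M : ℕ) [NeZero M] (I : Type) (_i₀ : I) (η₀ L₀ M₀ Rg : ℕ → ℝ) (Hg : ℕ → Prop) (μ₀ : Fin 4) (w₀ : W)
        (q : Consts190) (δr : ℝ) (_hδr : 0 < δr) (_hσ₀ : 0 < q.σ) (_hcR : B6.c0 δr (q.σ / δr) ^ 4 ≤ q.cR) (_hκB : 1 ≤ q.κB)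
        (_hδ15 : q.δ15 ≤ δs) (_hCst : Cs ≤ q.Cst) (_hmw : ‖w₀‖ ≤ q.m) (_hθ1 : q.θ ≤ 1)
        (γ₀ : ℝ) (μ ν : Fin 4) (α₂ : ℝ) (c₀ : B13.Consts) (s : ℝ) (_hs0 : 0 < s),
      -- ★ A THRESHOLD, AND THE PRODUCT AT EVERY MEMBER BELOW IT (downward-closed in the (2.9) letter `ε₂₉`)
      ∃ ē : ℝ, 0 < ē ∧ ∀ ε₂₉ : ℝ, 0 < ε₂₉ → ε₂₉ ≤ ē →
      4 * ε₂₉ < ε₀ ∧ (theta13OfThm1CCM F N j ε₀ ε₂₉ B₃ B₃' a₀ a₁).Admissible F N ∧ (theta13OfThm1CCM F N j ε₀ ε₂₉ B₃ B₃' a₀ a₁).ZtUnity F N ∧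
      ∀ -- AT THAT MEMBER: a Stage-12 [B13] FAMILY of record with the FAITHFUL letters (minimal `A₂`), the box, the leaf kernels with the (1.22) identification
        (lamF : ResidB13Fam₁₂ F N (theta13OfThm1CCM F N j ε₀ ε₂₉ B₃ B₃' a₀ a₁).toStage12Params)
        (_hle : γ₀ ≤ (theta13OfThm1CCM F N j ε₀ ε₂₉ B₃ B₃' a₀ a₁).γ) (A1 : (k : ℕ) → (Fin (k + 1) → ℝ) → LDom 4 → Pt 4 → ℝ)
        (_hm : letI := (theta13OfThm1CCM F N j ε₀ ε₂₉ B₃ B₃' a₀ a₁).instVβ₁; letI := (theta13OfThm1CCM F N j ε₀ ε₂₉ B₃ B₃' a₀ a₁).instVβ₂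
          letI := (theta13OfThm1CCM F N j ε₀ ε₂₉ B₃ B₃' a₀ a₁).instιβ
          ∀ k (v : Fin (k + 1) → ℝ), v ∈ Box γ₀ k →
            betaMerged F (mergedTermFamilyMatT F N (TcanOfRecord F N)
                (chiFixed29 F N (theta13OfThm1CCM F N j ε₀ ε₂₉ B₃ B₃' a₀ a₁).ν (theta13OfThm1CCM F N j ε₀ ε₂₉ B₃ B₃' a₀ a₁).ε₂₉)
                (theta13OfThm1CCM F N j ε₀ ε₂₉ B₃ B₃' a₀ a₁).εbg) (theta13OfThm1CCM F N j ε₀ ε₂₉ B₃ B₃' a₀ a₁).ρ8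
                (theta13OfThm1CCM F N j ε₀ ε₂₉ B₃ B₃' a₀ a₁).bV k v =
              beta0OfMerged (betaMerged F (mergedTermFamilyMatT F N (TcanOfRecord F N)
                  (chiFixed29 F N (theta13OfThm1CCM F N j ε₀ ε₂₉ B₃ B₃' a₀ a₁).ν (theta13OfThm1CCM F N j ε₀ ε₂₉ B₃ B₃' a₀ a₁).ε₂₉)
                  (theta13OfThm1CCM F N j ε₀ ε₂₉ B₃ B₃' a₀ a₁).εbg) (theta13OfThm1CCM F N j ε₀ ε₂₉ B₃ B₃' a₀ a₁).ρ8
                  (theta13OfThm1CCM F N j ε₀ ε₂₉ B₃ B₃' a₀ a₁).bV) (theta13OfThm1CCM F N j ε₀ ε₂₉ B₃ B₃' a₀ a₁).v₀ k +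
                B12Beta.secondMoment (fun _ _ => limKernel (A1 k v)) μ ν)
        -- N10's in-edge in the FAMILY currency at every run and the member letters law on the box, at the Stage-12 part (faithful letters of record of the member)
        (_hcF : ∀ P k v, v ∈ Box γ₀ k → (lamF P k v).c = c13OfRecord₁₂ F N (theta13OfThm1CCM F N j ε₀ ε₂₉ B₃ B₃' a₀ a₁).toStage12Params { c₀ with ε₁ := ε₂₉, A₂ := Real.exp 1 * 9 * 64 * K₀ 64 8 ^ 2 })
        (_hleafF : ∀ P, B13FamLeafOfRecord₁₂ F N (theta13OfThm1CCM F N j ε₀ ε₂₉ B₃ B₃' a₀ a₁).toStage12Params { c₀ with ε₁ := ε₂₉, A₂ := Real.exp 1 * 9 * 64 * K₀ 64 8 ^ 2 } lamF P)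
        -- per (scale, history) IN THE BOX: a RUN SEQUENCE whose members AT THAT HISTORY have growing coarse tori, their laws and restriction sentences
        (Ps : (k : ℕ) → (Fin (k + 1) → ℝ) → ℕ → B12.RunParams)
        (_hn : ∀ k v, v ∈ Box γ₀ k → Tendsto (fun m => (lamF (Ps k v m) k v).n) atTop atTop)
        (_hsp : ∀ k v, v ∈ Box γ₀ k → ∀ m, SpLaw (lamF (Ps k v m) k v))
        (_h213 : ∀ k v, v ∈ Box γ₀ k → ∀ m, Law213 (lamF (Ps k v m) k v))
        (_hR : ∀ k v, v ∈ Box γ₀ k → ∀ m, (lamF (Ps k v m) k v).Restr)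
        -- N3 (N1 and the seam row are PAID by the choice of the member)
        (_hs : SignsL (c13OfRecord₁₂ F N (theta13OfThm1CCM F N j ε₀ ε₂₉ B₃ B₃' a₀ a₁).toStage12Params { c₀ with ε₁ := ε₂₉, A₂ := Real.exp 1 * 9 * 64 * K₀ 64 8 ^ 2 }) α₂ q.B₃)
        -- ANY admissible regularity display and positivity witness of `Δ_{a,k}(1)` per (k, v, m) on the tower over the member's torus
        (αU : (k : ℕ) → (Fin (k + 1) → ℝ) → ℕ → ℕ → ℝ) (hα1 : ∀ k v m j, αU k v m j ≤ 1 / 64)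
        (hαL : ∀ k v m j, 50 * (((4 : ℕ) : ℝ) + 1) * αU k v m j * (L : ℝ) ^ 4 ≤ 1 / 2)
        (hU1 : ∀ k v m (j : ℕ) (z : B7Prop1Explicit.Site 4) (κ : Fin 4),
          perCfg (towerP L (fun _ : Fin 4 => NOfLayers (fun m => lamF (Ps k v m) k v) m * M) (j + 1))
            (UlevOf L (fun _ : Fin 4 => NOfLayers (fun m => lamF (Ps k v m) k v) m * M) (k + 1) (fun _ => (1 : 𝔸ˣ)) j) z κ ∈ U1 𝔸)
        (hreg : ∀ k v m (j : ℕ) (y : TSite 4 (towerP L (fun _ : Fin 4 => NOfLayers (fun m => lamF (Ps k v m) k v) m * M) j)) (κ : Fin 4)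
          (ρ' : Fin 4 → Fin L),
          ‖((Wcx L (perCfg (towerP L (fun _ : Fin 4 => NOfLayers (fun m => lamF (Ps k v m) k v) m * M) (j + 1))
              (UlevOf L (fun _ : Fin 4 => NOfLayers (fun m => lamF (Ps k v m) k v) m * M) (k + 1) (fun _ => (1 : 𝔸ˣ)) j))
              (cornerSite L y) κ (boxVec L ρ') : 𝔸ˣ) : 𝔸) - 1‖ ≤ αU k v m j)
        (hpos : ∀ k v m (u : BondL2K ℂ 4 (towerP L (fun _ : Fin 4 => NOfLayers (fun m => lamF (Ps k v m) k v) m * M) (k + 1)) (cw₀ k) W), u ≠ 0 →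
          0 < RCLike.re ⟪u, laplaceAk L (fun _ : Fin 4 => NOfLayers (fun m => lamF (Ps k v m) k v) m * M) k φ (η k) (fun _ => (1 : 𝔸ˣ)) hL
            (αU k v m) (hα1 k v m) (hU1 k v m) (hreg k v m) τ (c₀ := cw₀ k) (c₁ := cw₁ k) aQ u⟫_ℂ)
        -- the (4.4) seams FROM THE TOWER's FINE BOND FIELDS into the members' spaces p. 15, the members' ACTIVITIES holomorphic along them (on the box)
        (emb : (k : ℕ) → (v : Fin (k + 1) → ℝ) → (m : ℕ) → TDom 4 ((lamF (Ps k v m) k v).n + 1) → (Bond 4 (towerP L (fun _ : Fin 4 => NOfLayers (fun m => lamF (Ps k v m) k v) m * M) (k + 1)) → W) → (lamF (Ps k v m) k v).Φ)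
        (_hemb : ∀ k v, v ∈ Box γ₀ k → ∀ m X, ∀ u ∈ ball (0 : Bond 4 (towerP L (fun _ : Fin 4 => NOfLayers (fun m => lamF (Ps k v m) k v) m * M) (k + 1)) → W) α₂, emb k v m X u ∈ (lamF (Ps k v m) k v).sp2 X)
        (_hH : ∀ k v, v ∈ Box γ₀ k → ∀ m (X Z : TDom 4 ((lamF (Ps k v m) k v).n + 1)), Z.1 ⊆ X.1 →
          DifferentiableOn ℂ (fun u => (lamF (Ps k v m) k v).H Z (emb k v m X u)) (ball 0 α₂))
        -- the (1.7) ∕ test-vector-limit data (on the box), the limit READ ON THE EXPLICIT FLAT TEST VECTORS, and the read-out of the leaf kernels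
        (V : (k : ℕ) → (Fin (k + 1) → ℝ) → LDom 4 → Type) (_instV : ∀ k v Y, NormedAddCommGroup (V k v Y))
        (_instVs : ∀ k v Y, NormedSpace ℂ (V k v Y))
        (Fw : (k : ℕ) → (v : Fin (k + 1) → ℝ) → (Y : LDom 4) → V k v Y → ℂ)
        (_hFd : ∀ k v, v ∈ Box γ₀ k → ∀ Y, ∃ ρ > 0, DifferentiableOn ℂ (Fw k v Y) (ball 0 ρ))
        (r : (k : ℕ) → (v : Fin (k + 1) → ℝ) → (m : ℕ) → (Y : LDom 4) → (Bond 4 (towerP L (fun _ : Fin 4 => NOfLayers (fun m => lamF (Ps k v m) k v) m * M) (k + 1)) → W) →L[ℂ] V k v Y)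
        (_hfac : ∀ k v, v ∈ Box γ₀ k → ∀ Y : LDom 4, ∀ᶠ m in atTop, ∀ u ∈ ball (0 : Bond 4 (towerP L (fun _ : Fin 4 => NOfLayers (fun m => lamF (Ps k v m) k v) m * M) (k + 1)) → W) α₂,
          (lamF (Ps k v m) k v).Ek1 (tproj ((lamF (Ps k v m) k v).n + 1) Y) (emb k v m (tproj ((lamF (Ps k v m) k v).n + 1) Y) u) = Fw k v Y (r k v m Y u))
        (t : (k : ℕ) → (v : Fin (k + 1) → ℝ) → (Y : LDom 4) → Pt 4 → V k v Y)
        (_hconv : ∀ k v, v ∈ Box γ₀ k → ∀ (Y : LDom 4) (x : Pt 4),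
          Tendsto (fun m => r k v m Y
            (fun b : Bond 4 (towerP L (fun _ : Fin 4 => NOfLayers (fun m => lamF (Ps k v m) k v) m * M) (k + 1)) =>
              if tcubeOf (NOfLayers (fun m => lamF (Ps k v m) k v) m) M (fun i => ((blockCoord (L ^ (k + 1)) (fun _ : Fin 4 => NOfLayers (fun m => lamF (Ps k v m) k v) m * M)
                    (siteCast (towerP_eq_fineP_pow L (fun _ : Fin 4 => NOfLayers (fun m => lamF (Ps k v m) k v) m * M) (k + 1)) (bpos b)) i : ℕ) :
                      ZMod (NOfLayers (fun m => lamF (Ps k v m) k v) m * M))) ∈ (tproj ((lamF (Ps k v m) k v).n + 1) Y).1 then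
                ((WL2.linearEquiv ℂ ℂ (fun _ : Bond 4 (towerP L (fun _ : Fin 4 => NOfLayers (fun m => lamF (Ps k v m) k v) m * M) (k + 1)) => cw₀ k) :
                    BondL2K ℂ 4 (towerP L (fun _ : Fin 4 => NOfLayers (fun m => lamF (Ps k v m) k v) m * M) (k + 1)) (cw₀ k) W ≃ₗ[ℂ] (Bond 4 (towerP L (fun _ : Fin 4 => NOfLayers (fun m => lamF (Ps k v m) k v) m * M) (k + 1)) → W))
                  (H1k L (fun _ : Fin 4 => NOfLayers (fun m => lamF (Ps k v m) k v) m * M) k φ (η k) (fun _ => (1 : 𝔸ˣ)) hL (αU k v m) (hα1 k v m)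
                    (hU1 k v m) (hreg k v m) τ (c₀ := cw₀ k) (c₁ := cw₁ k) (hαL k v m) (hpos k v m)
                    ((WL2.linearEquiv ℂ ℂ (fun _ : Bond 4 (fun _ : Fin 4 => NOfLayers (fun m => lamF (Ps k v m) k v) m * M) => cw₁ k) :
                        BondL2K ℂ 4 (fun _ : Fin 4 => NOfLayers (fun m => lamF (Ps k v m) k v) m * M) (cw₁ k) W ≃ₗ[ℂ]
                          (Bond 4 (fun _ : Fin 4 => NOfLayers (fun m => lamF (Ps k v m) k v) m * M) → W)).symm
                      (Pi.single ((fun i => (⟨((proj (((lamF (Ps k v m) k v).n + 1) * M) x) i).val,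
                          ZMod.val_lt ((proj (((lamF (Ps k v m) k v).n + 1) * M) x) i)⟩ : Fin (NOfLayers (fun m => lamF (Ps k v m) k v) m * M))), μ₀) w₀)))) b
              else 0)) atTop (𝓝 (t k v Y x)))
        (_ha : ∀ k v, v ∈ Box γ₀ k → ∀ (Y : LDom 4) (z : Pt 4), A1 k v Y z = (mixedDeriv (Fw k v Y) (t k v Y 0) (t k v Y z)).re)
        -- the box is a positive box, the (190) numerics validity at the letters, (C-leaf) in the (1.7) read-out letters
        (_hq : q.Valid (c13OfRecord₁₂ F N (theta13OfThm1CCM F N j ε₀ ε₂₉ B₃ B₃' a₀ a₁).toStage12Params { c₀ with ε₁ := ε₂₉, A₂ := Real.exp 1 * 9 * 64 * K₀ 64 8 ^ 2 }).δ₀)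
        (_hcont : ∀ k (Y : LDom 4) (z : Pt 4),
          ContinuousOn (fun v : Fin (k + 1) → ℝ => (mixedDeriv (Fw k v Y) (t k v Y 0) (t k v Y z)).re) (Box γ₀ k)),
      letI := (theta13OfThm1CCM F N j ε₀ ε₂₉ B₃ B₃' a₀ a₁).instVβ₁; letI := (theta13OfThm1CCM F N j ε₀ ε₂₉ B₃ B₃' a₀ a₁).instVβ₂
      letI := (theta13OfThm1CCM F N j ε₀ ε₂₉ B₃ B₃' a₀ a₁).instιβ
      -- ★ the rows-(D4) ∧ B4 residue AT THE DISPLAYED BOX `γ₀` and the free slope `s` (NODE D supplied), and its β-BOX corollary from the (D1) drift letters there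
      AtSlopeCont
          (oneLoopSplit_betaOfMerged
            (betaMerged F (mergedTermFamilyMatT F N (TcanOfRecord F N)
              (chiFixed29 F N (theta13OfThm1CCM F N j ε₀ ε₂₉ B₃ B₃' a₀ a₁).ν (theta13OfThm1CCM F N j ε₀ ε₂₉ B₃ B₃' a₀ a₁).ε₂₉)
              (theta13OfThm1CCM F N j ε₀ ε₂₉ B₃ B₃' a₀ a₁).εbg) (theta13OfThm1CCM F N j ε₀ ε₂₉ B₃ B₃' a₀ a₁).ρ8
              (theta13OfThm1CCM F N j ε₀ ε₂₉ B₃ B₃' a₀ a₁).bV)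
            (beta0OfMerged (betaMerged F (mergedTermFamilyMatT F N (TcanOfRecord F N)
              (chiFixed29 F N (theta13OfThm1CCM F N j ε₀ ε₂₉ B₃ B₃' a₀ a₁).ν (theta13OfThm1CCM F N j ε₀ ε₂₉ B₃ B₃' a₀ a₁).ε₂₉)
              (theta13OfThm1CCM F N j ε₀ ε₂₉ B₃ B₃' a₀ a₁).εbg) (theta13OfThm1CCM F N j ε₀ ε₂₉ B₃ B₃' a₀ a₁).ρ8
              (theta13OfThm1CCM F N j ε₀ ε₂₉ B₃ B₃' a₀ a₁).bV) (theta13OfThm1CCM F N j ε₀ ε₂₉ B₃ B₃' a₀ a₁).v₀)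
            (theta13OfThm1CCM F N j ε₀ ε₂₉ B₃ B₃' a₀ a₁).γ)
          γ₀ s ∧
      ∀ d A b β' : ℝ,
        OneLoopDrift d A
          (beta0OfMerged (betaMerged F (mergedTermFamilyMatT F N (TcanOfRecord F N)
            (chiFixed29 F N (theta13OfThm1CCM F N j ε₀ ε₂₉ B₃ B₃' a₀ a₁).ν (theta13OfThm1CCM F N j ε₀ ε₂₉ B₃ B₃' a₀ a₁).ε₂₉)
            (theta13OfThm1CCM F N j ε₀ ε₂₉ B₃ B₃' a₀ a₁).εbg) (theta13OfThm1CCM F N j ε₀ ε₂₉ B₃ B₃' a₀ a₁).ρ8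
            (theta13OfThm1CCM F N j ε₀ ε₂₉ B₃ B₃' a₀ a₁).bV) (theta13OfThm1CCM F N j ε₀ ε₂₉ B₃ B₃' a₀ a₁).v₀) →
        b ≤ d - 2 * A - s → d + 2 * A + s ≤ β' →
        BetaLowerH b γ₀ (betaOfRecord₁₃ F N (theta13OfThm1CCM F N j ε₀ ε₂₉ B₃ B₃' a₀ a₁)) ∧ BetaUpperH β' γ₀ (betaOfRecord₁₃ F N (theta13OfThm1CCM F N j ε₀ ε₂₉ B₃ B₃' a₀ a₁)) :=
  exists_thr_atSlopeCont_betaBox_below_theta13LiveOfNumerics_of_family_towerFlat F N L hL hL3 φ hMφ hMφ' hφ hφ' haQ haQ' τ hτ hCτ hτm hMτ hρw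
    hτ₁ hτ₂ hφτ AQ hAQ16 (n := stage12NumericsOfThm1CCM F.L j ε₀ B₃ B₃' a₀ a₁)
    (kappaThreshold_le_2e4.trans (kp_n10_theta13OfThm1CCM F N j ε₀ 0 B₃ B₃' a₀ a₁)) (stage12NumericsOfThm1CCM_pos F.hL.2.le hε hB hB' ha₀ ha₁)

end Below

/-! ## §2 V17's sign-free β-box 3ᴬ at `θ₁₅ᶜᶜᴹ(j)` from the jets-free pair there, BY NAME -/

section SignFree

variable (j : ℕ) (ε₀ ε₂₉ B₃ B₃' a₀ a₁ : ℝ)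

/-- **V17's β-LEAF SHAPE 3ᴬ AT `θ₁₅ᶜᶜᴹ(j)` FROM THE JETS-FREE PAIR AT THAT RECORD** — (I) `exists_betaBox_betaOfRecord₁₃_of_jetsFreePair` (p518667) read at `θ := θ₁₅ᶜᶜᴹ(j)`: «`∃ d ≥ 0, A,
OneLoopDrift d A β⁰(θ₁₅ᶜᶜᴹ(j)) ∧ ∃ γ₀ ∈ ]0, ½], AtSlopeCont (split₁₃ θ₁₅ᶜᶜᴹ(j)) γ₀ d`» ((D1) drift + the (D4) residue — §1 supplies the latter below a threshold modulo its displayed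
inputs) ⟹ `∃ γ₀ ∈ ]0, ½], ∃ β′ ≥ 0, BetaUpperH β′ γ₀ β₁₃ ∧ BetaLowerH (−β′) γ₀ β₁₃ ∧ BetaContH γ₀ β₁₃`, `β₁₃ = betaOfRecord₁₃ F N θ₁₅ᶜᶜᴹ(j)` (`θ₁₅ᶜᶜᴹ(j).γ = ½` is `rfl`).  This is
the sign-free box «`BetaLowerH (−β′) ∧ BetaUpperH β′` on SOME window» of ym-nodeO-ideate P3 EVIDENCE n°78 ∕ plan g77's announced V17 stub 3ᴬ, at the witness they name, with B4 as a
rider.  A by-name instantiation; the pair is a HYPOTHESIS; instance 0∕1. [cite: Balaban1987RG1, Thm 2 p.259, §1 p.264, (2.12)–(2.14) p.268 and (5.10) p.293; Balaban1988RG2Cluster, Lemma 3 (2.38) p.20] -/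
theorem exists_betaBox_betaOfRecord₁₃_theta13OfThm1CCM_of_jetsFreePair
    (h : letI := (theta13OfThm1CCM F N j ε₀ ε₂₉ B₃ B₃' a₀ a₁).instVβ₁; letI := (theta13OfThm1CCM F N j ε₀ ε₂₉ B₃ B₃' a₀ a₁).instVβ₂
      letI := (theta13OfThm1CCM F N j ε₀ ε₂₉ B₃ B₃' a₀ a₁).instιβ
      ∃ d A : ℝ, 0 ≤ d ∧
        OneLoopDrift d A (beta0OfMerged (betaMerged F (mergedTermFamilyMatT F N (TcanOfRecord F N)
          (chiFixed29 F N (theta13OfThm1CCM F N j ε₀ ε₂₉ B₃ B₃' a₀ a₁).ν (theta13OfThm1CCM F N j ε₀ ε₂₉ B₃ B₃' a₀ a₁).ε₂₉)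
          (theta13OfThm1CCM F N j ε₀ ε₂₉ B₃ B₃' a₀ a₁).εbg) (theta13OfThm1CCM F N j ε₀ ε₂₉ B₃ B₃' a₀ a₁).ρ8 (theta13OfThm1CCM F N j ε₀ ε₂₉ B₃ B₃' a₀ a₁).bV)
          (theta13OfThm1CCM F N j ε₀ ε₂₉ B₃ B₃' a₀ a₁).v₀) ∧
        ∃ γ₀ : ℝ, 0 < γ₀ ∧ γ₀ ≤ 1 / 2 ∧
          AtSlopeCont
            (oneLoopSplit_betaOfMerged
              (betaMerged F (mergedTermFamilyMatT F N (TcanOfRecord F N)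
                (chiFixed29 F N (theta13OfThm1CCM F N j ε₀ ε₂₉ B₃ B₃' a₀ a₁).ν (theta13OfThm1CCM F N j ε₀ ε₂₉ B₃ B₃' a₀ a₁).ε₂₉)
                (theta13OfThm1CCM F N j ε₀ ε₂₉ B₃ B₃' a₀ a₁).εbg) (theta13OfThm1CCM F N j ε₀ ε₂₉ B₃ B₃' a₀ a₁).ρ8 (theta13OfThm1CCM F N j ε₀ ε₂₉ B₃ B₃' a₀ a₁).bV)
              (beta0OfMerged (betaMerged F (mergedTermFamilyMatT F N (TcanOfRecord F N)
                (chiFixed29 F N (theta13OfThm1CCM F N j ε₀ ε₂₉ B₃ B₃' a₀ a₁).ν (theta13OfThm1CCM F N j ε₀ ε₂₉ B₃ B₃' a₀ a₁).ε₂₉)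
                (theta13OfThm1CCM F N j ε₀ ε₂₉ B₃ B₃' a₀ a₁).εbg) (theta13OfThm1CCM F N j ε₀ ε₂₉ B₃ B₃' a₀ a₁).ρ8 (theta13OfThm1CCM F N j ε₀ ε₂₉ B₃ B₃' a₀ a₁).bV)
                (theta13OfThm1CCM F N j ε₀ ε₂₉ B₃ B₃' a₀ a₁).v₀) (1 / 2))
            γ₀ d) :
    ∃ γ₀ : ℝ, 0 < γ₀ ∧ γ₀ ≤ 1 / 2 ∧ ∃ β' : ℝ, 0 ≤ β' ∧
      BetaUpperH β' γ₀ (betaOfRecord₁₃ F N (theta13OfThm1CCM F N j ε₀ ε₂₉ B₃ B₃' a₀ a₁)) ∧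
      BetaLowerH (-β') γ₀ (betaOfRecord₁₃ F N (theta13OfThm1CCM F N j ε₀ ε₂₉ B₃ B₃' a₀ a₁)) ∧
      BetaContH γ₀ (betaOfRecord₁₃ F N (theta13OfThm1CCM F N j ε₀ ε₂₉ B₃ B₃' a₀ a₁)) :=
  exists_betaBox_betaOfRecord₁₃_of_jetsFreePair F N (theta13OfThm1CCM F N j ε₀ ε₂₉ B₃ B₃' a₀ a₁) h

end SignFree

end Summit.QuantumFields.YangMills.Theorems.BalabanUVNodesN26AtTheta13OfThm1CCMStubD4Below

end
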